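import Mathlib
import Literature.AlgebraicGeometry.Resolution.CobordantGame

/-!
# `LocalWeightedDrop`: winning strategies may carry auxiliary data (the game is memoryless, its strategies need not be)

Route `ResolutionOfSingularities/WeightedInvariant`, crux `LocalWeightedDrop` (stmt-ResolutionOfSingularities-8899), line
`hasse-ridge-face-selection` (chain w43, [OURS · L1 W4.3]).  The winning region `CobordantGame.Won` is INDUCTIVE: a germ is won
iff some legal move has all its singular successors won.  Consequently a resolution ALGORITHM WITH MEMORY (e.g. the
Cossart–Jannsen–Saito descent for surfaces, whose centre choice and invariant depend on the BOUNDARY created by the earlier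
blow-ups) proves `Won` for every germ it treats, although the game position is the bare germ: run the algorithm on STATES
`(germ, bookkeeping data)` and induct on a well-founded measure of the state.  This file records that bridge once, so that the
residual surface pieces S2/S3 of skeleton v20 can be attacked with the printed (history-dependent) invariants verbatim:
* `won_of_stateMeasure` — states `s : S` with germs in a fixed number `N` of variables, an ordinal measure `μ`, and for every
  state a legal move such that each singular successor `g` is won as soon as the germs of some states of smaller measure are
  won (e.g. `g = u · Φ(cyl Sl)` over a tame slice `Sl` that is the germ of a smaller state, or `g` won outright) ⇒ every
  state's germ is won;
* `won_of_stateMeasure_nat` — the same with an `ℕ`-valued (or any well-founded) measure, via `WellFounded`.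
-/

set_option linter.dupNamespace false -- mandated namespace of this single-conjunct summit

namespace Summit.ResolutionOfSingularities.ResolutionOfSingularities.Theorems

open Literature.AlgebraicGeometry.Resolution

namespace StrategyData

variable {k : Type} [Field k]

/-- WINNING WITH AUXILIARY DATA.  Let `S` be any type of states, each with a germ `germ s` in `N` variables and an ordinal
measure `μ s`.  Suppose every state admits a legal move all of whose singular successors `g` are won as soon as the germs of
all states in some family `T` of states of STRICTLY SMALLER measure are won.  Then the germ of every state is won.
(Transfinite induction on `μ`; the bookkeeping data never enters the game position.) -/
theorem won_of_stateMeasure {S : Type*} {N : ℕ} (germ : S → MvPowerSeries (Fin N) k) (μ : S → Ordinal.{0})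
    (hstep : ∀ s : S, ∃ (θ : Fin N → MvPowerSeries (Fin N) k) (w : Fin N → ℕ), CobordantGame.IsMove k θ w ∧
      ∀ g : MvPowerSeries (Fin (N + 1)) k, CobordantGame.IsSuccessor k (germ s) θ w g →
        ∃ T : Set S, (∀ s' ∈ T, μ s' < μ s) ∧
          ((∀ s' ∈ T, CobordantGame.Won k N (germ s')) → CobordantGame.Won k (N + 1) g)) :
    ∀ s : S, CobordantGame.Won k N (germ s) := by
  suffices key : ∀ (α : Ordinal.{0}) (s : S), μ s = α → CobordantGame.Won k N (germ s) from fun s => key _ s rfl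
  intro α
  induction α using WellFoundedLT.induction with
  | ind α ih =>
    intro s hα
    obtain ⟨θ, w, hm, hs⟩ := hstep s
    refine CobordantGame.Won.move θ w hm fun g hg => ?_
    obtain ⟨T, hT, hwin⟩ := hs g hg
    exact hwin fun s' hs' => ih (μ s') (hα ▸ hT s' hs') s' rfl

/-- The same bridge with a measure valued in any type carrying a well-founded `<` (e.g. `ℕ`, or a lexicographic product of
polygon invariants). -/
theorem won_of_stateMeasure_wf {S M : Type*} [LT M] [WellFoundedLT M] {N : ℕ} (germ : S → MvPowerSeries (Fin N) k)
    (μ : S → M)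
    (hstep : ∀ s : S, ∃ (θ : Fin N → MvPowerSeries (Fin N) k) (w : Fin N → ℕ), CobordantGame.IsMove k θ w ∧
      ∀ g : MvPowerSeries (Fin (N + 1)) k, CobordantGame.IsSuccessor k (germ s) θ w g →
        ∃ T : Set S, (∀ s' ∈ T, μ s' < μ s) ∧
          ((∀ s' ∈ T, CobordantGame.Won k N (germ s')) → CobordantGame.Won k (N + 1) g)) :
    ∀ s : S, CobordantGame.Won k N (germ s) := by
  suffices key : ∀ (m : M) (s : S), μ s = m → CobordantGame.Won k N (germ s) from fun s => key _ s rfl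
  intro m
  induction m using WellFoundedLT.induction with
  | ind m ih =>
    intro s hm
    obtain ⟨θ, w, hmv, hs⟩ := hstep s
    refine CobordantGame.Won.move θ w hmv fun g hg => ?_
    obtain ⟨T, hT, hwin⟩ := hs g hg
    exact hwin fun s' hs' => ih (μ s') (hm ▸ hT s' hs') s' rfl

/-- CONVERSELY the bookkeeping is never needed in principle: the germs of won states form themselves a family of states
with the least game value as measure (`CobordantGame.leastRank`), so a data-carrying strategy and a positional one win the
same germs.  Recorded as the trivial direction: if every state's germ is won, the hypothesis of `won_of_stateMeasure`
holds with `μ := leastRank ∘ germ` and `T := ∅`-free direct wins. -/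
theorem stateMeasure_of_won {S : Type*} {N : ℕ} (germ : S → MvPowerSeries (Fin N) k)
    (h : ∀ s : S, CobordantGame.Won k N (germ s)) :
    ∀ s : S, ∃ (θ : Fin N → MvPowerSeries (Fin N) k) (w : Fin N → ℕ), CobordantGame.IsMove k θ w ∧
      ∀ g : MvPowerSeries (Fin (N + 1)) k, CobordantGame.IsSuccessor k (germ s) θ w g →
        ∃ T : Set S, (∀ s' ∈ T, CobordantGame.leastRank N (germ s') < CobordantGame.leastRank N (germ s)) ∧
          ((∀ s' ∈ T, CobordantGame.Won k N (germ s')) → CobordantGame.Won k (N + 1) g) := by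
  intro s
  obtain ⟨θ, w, hm, hs⟩ := h s
  exact ⟨θ, w, hm, fun g hg => ⟨∅, fun _ h' => absurd h' (Set.notMem_empty _), fun _ => hs g hg⟩⟩

end StrategyData

end Summit.ResolutionOfSingularities.ResolutionOfSingularities.Theorems
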